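import Summits.QuantumFields.BalabanUV.T4Continuum.Support.NE3CovariantLineSums
import Summits.QuantumFields.BalabanUV.T4Continuum.Support.NE3TangentCovariantTower
import Summits.QuantumFields.BalabanUV.T4Continuum.Support.BlockAverageDbarLinNorms
import HarnessLib

/-!
# T⁴ programme, node NE3, row E-MLw-(w4)-P · C1 (file 2) — THE TOWER OF STRAIGHT COVARIANT BLOCK-LINE AVERAGES `QstrIter`, THE EXACT
# ERROR RECURSION `QbarIter = QstrIter + ErrIter`, one-level SUP bounds, and «S_W = D_U μ + E» on T(W) at every level

NE3 formalisation swarm `b2b-balaban-t4-ne3-formalise-*`, LEAF PROVER 04 (gen 4), row **C1** of the owner's cut of the (w4)-P core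
(`t4-ne3-p1-g21`, D-ne3p1-g21-1 §3 (C1) ∕ §4; CLAIM HOME/CLAIMS.log ≈15:02Z), file 2 after `NE3CovariantLineSums` (one level: `Qstr`, `locL1`,
`‖Qbar − Qstr‖ ≤ 16(d+1)(d+4)L²a·locL1`).

CONTENT (all [folklore]; 0 sorry; DATA defs `Dstr`, `QstrIter`, `ErrIter` by structural recursion, inner-first like `QbarIter` → async audit):
§1 `Dstr := Qbar − Qstr` (the one-level defect), `Qstr_add` (EXACT additivity: `dhol_add`, `Ad_add`; no smallness), `QstrIter`, `QstrIter_add`,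
   `ErrIter` (`ErrIter 0 = 0`, `ErrIter (j+1) W Y = ErrIter j (cavg W) (Qstr W Y) + QbarIter j (cavg W) (Dstr W Y)`);
§2 `QbarIter_add` (small-field tower, from w4-S `Qbar_add`) and **`QbarIter_eq_QstrIter_add_ErrIter`** — the EXACT error recursion
   `QbarIter L (j+1) W Y = QstrIter L (j+1) W Y + ErrIter L (j+1) W Y` in the multi-level small-field class (hypotheses of
   `NE3TangentCovariantTower.dirIter_add`);
§3 **`QstrIter_eq_neg_gaugeDir_sub_ErrIter_of_tangentIter`** — on T(W): `QstrIter L (j+1) W Y = −gaugeDir (cavgIter L (j+1) W) (framePotW L (j+1) W Y)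
   − ErrIter L (j+1) W Y` («S_W = D_U μ + E» at every level, μ = the accumulated frames of w4-S, E = `−ErrIter`);
§4 ONE-LEVEL SUP BOUNDS (the inputs of the k-uniform estimate of `ErrIter`, file 3): for `‖Y(b)‖ ≤ s` on the bonds within l¹-distance
   `nbRad d L` of `L•z`: `‖Qstr L W Y z κ‖ ≤ L·s` (EXACT weight, isometric transports) and `‖Dstr L W Y z κ‖ ≤ 16(d+1)(d+4)L²a·(1250(nbRad + L) + 8dL + 2L)·s`;
§5 flat check: `Qstr_flat = Qcoarse`, `Dstr_flat = 0`, `QstrIter_flat = (Qcoarse L)^[j]`.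
WHAT FILE 3 DOES (this lineage): the k-uniform bound `‖ErrIter L k W Y‖ ≤ (Σ_{j<k} 16(d+1)(d+4)L²·radIter j a · C_sup(d,L)) · L^{k−1}·(local sup of Y)`,
geometric in the level inside `LevelSmall` (top level dominates: `≈ 32(d+1)(d+4)·(L^k)²a·C_sup`), from §2's recursion, §4, and the sup-contraction of `QstrIter`.

HONEST: covariant kinematics of the linearised averaging tower on OUR frame ([Balaban1985Averaging] (120)–(125) pp.35–36 context); nothing
about minimisers, (P_W), (ML_w), T-E_w or NE3 is asserted; NE3 NOT proved; spine 0∕9; finite T⁴ rung (B)+1 — NOT infinite volume, NOT mass gap,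
NOT BetaPertH, NOT Clay.  PLACEMENT: `Summits/QuantumFields/BalabanUV/`.
-/

set_option autoImplicit false

open scoped BigOperators Matrix.Norms.L2Operator
open Finset

namespace Summit.QuantumFields.BalabanUV.T4Continuum.NE3CovariantLineSumsTower

open Literature.MathematicalPhysics.QuantumFieldTheory.Balaban1983to89
open B7Prop1Explicit B7Prop2Explicit B7Prop3Flat
open T4AveragingDeficitWall (IsUnitaryCfg IsSkewDir SmallField Ad bavg_flat hol_flat)
open T4AveragingDeficitWallBoundary (IsPeriodicCfg)
open AveragingDeficitPeriodicCounting (IsPeriodicDir)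
open AveragingDeficitTransport (dhol lnorm norm_Ad_of_unitary)
open AveragingDeficitTransportCalc (dhol_add)
open AveragingDeficitNearIdentity (Ad_add Ad_one)
open AveragingDeficitSideDeriv (loopWord length_loopWord)
open AveragingDeficitChartCalculus (cavg)
open AveragingDeficitMultiLevelPrep (cpush cavgIter TangentIter tower LevelSmall)
open BlockAveragePushDirGauge (gaugeDir)
open BlockAveragePushDirSplit (flat dhol_flat)
open BlockAverageDbarLinBound (segMain loopL1 treeL1' segL1)
open BlockAverageDbarLinNorms (lnorm_le_length_mul_sup l1_natCast_smul_e)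
open BlockAverageVaryHolo (nbRad length_loopWord_le)
open NE3TangentFlatStructure (Qcoarse)
open NE3TangentCovariantStructure (Qbar Qbar_add norm_Wcx_sub_one_le_32)
open NE3TangentCovariantTower (QbarIter framePotW step_small QbarIter_succ QbarIter_zero QbarIter_eq_neg_gaugeDir_of_tangentIter Qbar_flat)
open NE3CovariantLineSums (Qstr locL1 wBall_le norm_Wcx_sub_one_le_wBall norm_Qbar_sub_Qstr_le)

noncomputable section

variable {d : ℕ} {n : Type*} [Fintype n] [DecidableEq n]

/-! ## §1 The defect, additivity, the towers -/

/-- THE ONE-LEVEL DEFECT `Dstr := Qbar − Qstr` (double-bar average minus straight covariant block-line average). [folklore] -/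
def Dstr (L : ℕ) (W : Site d → Fin d → (Matrix n n ℂ)ˣ) (Y : Site d → Fin d → Matrix n n ℂ) : Site d → Fin d → Matrix n n ℂ :=
  fun z κ => Qbar L W Y z κ - Qstr L W Y z κ

/-- `Qbar = Qstr + Dstr` pointwise. [folklore] -/
theorem Qbar_eq_Qstr_add_Dstr (L : ℕ) (W : Site d → Fin d → (Matrix n n ℂ)ˣ) (Y : Site d → Fin d → Matrix n n ℂ) :
    Qbar L W Y = fun z κ => Qstr L W Y z κ + Dstr L W Y z κ := by
  funext z κ; simp [Dstr]

/-- `Qstr` is EXACTLY additive in the direction (no smallness: `dhol_add`, `Ad_add`). [folklore] -/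
theorem Qstr_add (L : ℕ) (W : Site d → Fin d → (Matrix n n ℂ)ˣ) (A B : Site d → Fin d → Matrix n n ℂ) :
    Qstr L W (fun y μ => A y μ + B y μ) = fun z κ => Qstr L W A z κ + Qstr L W B z κ := by
  funext z κ
  have hAB : (fun y μ => A y μ + B y μ) = A + B := rfl
  simp only [Qstr, segMain, hAB, dhol_add, Ad_add, smul_add, Finset.sum_add_distrib]

/-- THE TOWER OF STRAIGHT COVARIANT BLOCK-LINE AVERAGES (inner-first): `QstrIter L 0 W Y = Y`,
`QstrIter L (j+1) W Y = QstrIter L j (cavg L W) (Qstr L W Y)`. [cite: Balaban1985Averaging, (125) p.36] -/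
def QstrIter (L : ℕ) : ℕ → (Site d → Fin d → (Matrix n n ℂ)ˣ) → (Site d → Fin d → Matrix n n ℂ) → Site d → Fin d → Matrix n n ℂ
  | 0, _, Y => Y
  | j + 1, W, Y => QstrIter L j (cavg L W) (Qstr L W Y)

/-- THE ACCUMULATED ERROR of the tower: `ErrIter L 0 W Y = 0`,
`ErrIter L (j+1) W Y = ErrIter L j (cavg L W) (Qstr L W Y) + QbarIter L j (cavg L W) (Dstr L W Y)`. [folklore] -/
def ErrIter (L : ℕ) : ℕ → (Site d → Fin d → (Matrix n n ℂ)ˣ) → (Site d → Fin d → Matrix n n ℂ) → Site d → Fin d → Matrix n n ℂ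
  | 0, _, _ => fun _ _ => 0
  | j + 1, W, Y => fun z κ => ErrIter L j (cavg L W) (Qstr L W Y) z κ + QbarIter L j (cavg L W) (Dstr L W Y) z κ

/-- `QstrIter L (j+1) W Y = QstrIter L j (cavg L W) (Qstr L W Y)`. [folklore] -/
theorem QstrIter_succ (L j : ℕ) (W : Site d → Fin d → (Matrix n n ℂ)ˣ) (Y : Site d → Fin d → Matrix n n ℂ) :
    QstrIter L (j + 1) W Y = QstrIter L j (cavg L W) (Qstr L W Y) := rfl

/-- `QstrIter L 0 W Y = Y`. [folklore] -/
theorem QstrIter_zero (L : ℕ) (W : Site d → Fin d → (Matrix n n ℂ)ˣ) (Y : Site d → Fin d → Matrix n n ℂ) : QstrIter L 0 W Y = Y := rfl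

/-- `ErrIter L (j+1) W Y = ErrIter L j (cavg L W) (Qstr L W Y) + QbarIter L j (cavg L W) (Dstr L W Y)`. [folklore] -/
theorem ErrIter_succ (L j : ℕ) (W : Site d → Fin d → (Matrix n n ℂ)ˣ) (Y : Site d → Fin d → Matrix n n ℂ) :
    ErrIter L (j + 1) W Y = fun z κ => ErrIter L j (cavg L W) (Qstr L W Y) z κ + QbarIter L j (cavg L W) (Dstr L W Y) z κ := rfl

/-- `ErrIter L 0 W Y = 0`. [folklore] -/
theorem ErrIter_zero (L : ℕ) (W : Site d → Fin d → (Matrix n n ℂ)ˣ) (Y : Site d → Fin d → Matrix n n ℂ) : ErrIter L 0 W Y = fun _ _ => 0 := rfl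

/-- `QstrIter` is EXACTLY additive at every level. [folklore] -/
theorem QstrIter_add (L : ℕ) : ∀ (j : ℕ) (W : Site d → Fin d → (Matrix n n ℂ)ˣ) (A B : Site d → Fin d → Matrix n n ℂ),
    QstrIter L j W (fun y μ => A y μ + B y μ) = fun z κ => QstrIter L j W A z κ + QstrIter L j W B z κ
  | 0, _, _, _ => rfl
  | j + 1, W, A, B => by
      rw [QstrIter_succ, QstrIter_succ, QstrIter_succ, Qstr_add]
      exact QstrIter_add L j (cavg L W) _ _

/-! ## §2 Additivity of the double-bar tower and the exact error recursion -/

/-- `QbarIter` is additive in the multi-level small-field class (w4-S `Qbar_add` at every level). [folklore] -/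
theorem QbarIter_add [Nonempty n] {L : ℕ} (hL : 1 ≤ L) (j : ℕ) :
    ∀ {W : Site d → Fin d → (Matrix n n ℂ)ˣ} {x : ℝ}, IsUnitaryCfg W → 0 ≤ x → LevelSmall d L j x → SmallField W x →
    ∀ (A B : Site d → Fin d → Matrix n n ℂ),
      QbarIter L (j + 1) W (fun y μ => A y μ + B y μ) = fun z κ => QbarIter L (j + 1) W A z κ + QbarIter L (j + 1) W B z κ := by
  induction j with
  | zero =>
      intro W x hWu hx hs hWx A B
      obtain ⟨h512, -, -, -⟩ := step_small hL hWu hx hs hWx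
      rw [zero_add, NE3TangentCovariantTower.QbarIter_one, NE3TangentCovariantTower.QbarIter_one, NE3TangentCovariantTower.QbarIter_one]
      exact Qbar_add hL hWu hx h512 hWx A B
  | succ j ih =>
      intro W x hWu hx hs hWx A B
      obtain ⟨h512, hW₁u, hr0, hW₁x⟩ := step_small hL hWu hx hs.1 hWx
      rw [QbarIter_succ L (j + 1) W, QbarIter_succ L (j + 1) W A, QbarIter_succ L (j + 1) W B, Qbar_add hL hWu hx h512 hWx A B]
      exact ih hW₁u hr0 hs.2 hW₁x _ _

/-- **THE EXACT ERROR RECURSION OF THE TOWER**: in the multi-level small-field class,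
`QbarIter L (j+1) W Y = QstrIter L (j+1) W Y + ErrIter L (j+1) W Y`. [folklore] -/
theorem QbarIter_eq_QstrIter_add_ErrIter [Nonempty n] {L : ℕ} (hL : 1 ≤ L) (j : ℕ) :
    ∀ {W : Site d → Fin d → (Matrix n n ℂ)ˣ} {x : ℝ}, IsUnitaryCfg W → 0 ≤ x → LevelSmall d L j x → SmallField W x →
    ∀ (Y : Site d → Fin d → Matrix n n ℂ),
      QbarIter L (j + 1) W Y = fun z κ => QstrIter L (j + 1) W Y z κ + ErrIter L (j + 1) W Y z κ := by
  induction j with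
  | zero =>
      intro W x _ _ _ _ Y
      rw [zero_add, NE3TangentCovariantTower.QbarIter_one, QstrIter_succ, QstrIter_zero, ErrIter_succ]
      funext z κ
      rw [ErrIter_zero, QbarIter_zero]
      simp [Dstr]
  | succ j ih =>
      intro W x hWu hx hs hWx Y
      obtain ⟨h512, hW₁u, hr0, hW₁x⟩ := step_small hL hWu hx hs.1 hWx
      rw [QbarIter_succ L (j + 1) W Y, Qbar_eq_Qstr_add_Dstr, QbarIter_add hL j hW₁u hr0 hs.2 hW₁x,
        ih hW₁u hr0 hs.2 hW₁x (Qstr L W Y), QstrIter_succ L (j + 1) W Y, ErrIter_succ L (j + 1) W Y]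
      funext z κ
      simp only [add_assoc]

/-! ## §3 «S_W = D_U μ + E» at every level -/

/-- **ON THE TANGENT SPACE THE STRAIGHT COVARIANT k-FOLD BLOCK-LINE AVERAGE IS A COARSE GAUGE DIRECTION UP TO THE ACCUMULATED ERROR**:
under the hypotheses of `NE3TangentCovariantTower.QbarIter_eq_neg_gaugeDir_of_tangentIter`,
`TangentIter L j W Y → QstrIter L (j+1) W Y = −gaugeDir (cavgIter L (j+1) W) (framePotW L (j+1) W Y) − ErrIter L (j+1) W Y`.
[cite: Balaban1985Averaging, (120)–(125) pp.35–36] -/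
theorem QstrIter_eq_neg_gaugeDir_sub_ErrIter_of_tangentIter [Nonempty n] {L M : ℕ} [NeZero M] (hL : 1 ≤ L) (j : ℕ)
    {W : Site d → Fin d → (Matrix n n ℂ)ˣ} {x : ℝ} (hWu : IsUnitaryCfg W) (hWP : IsPeriodicCfg W ((tower L M (j + 1) : ℕ) : ℤ))
    (hx : 0 ≤ x) (hs : LevelSmall d L j x) (hWx : SmallField W x) {Y : Site d → Fin d → Matrix n n ℂ} (hY : IsSkewDir Y)
    (hYP : IsPeriodicDir Y ((tower L M (j + 1) : ℕ) : ℤ)) (hT : TangentIter L j W Y) :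
    QstrIter L (j + 1) W Y = fun z κ =>
      -gaugeDir (cavgIter L (j + 1) W) (framePotW L (j + 1) W Y) z κ - ErrIter L (j + 1) W Y z κ := by
  have h1 := QbarIter_eq_neg_gaugeDir_of_tangentIter (M := M) hL j hWu hWP hx hs hWx hY hYP hT
  have h2 := QbarIter_eq_QstrIter_add_ErrIter hL j hWu hx hs hWx Y
  funext z κ
  have hz1 := congr_fun (congr_fun h1 z) κ
  have hz2 := congr_fun (congr_fun h2 z) κ
  rw [hz2] at hz1
  exact eq_sub_of_add_eq hz1

/-! ## §4 One-level sup bounds -/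

/-- **SUP BOUND OF THE STRAIGHT AVERAGE, EXACT WEIGHT `L`**: for unitary small-field `W` and `‖Y(b)‖ ≤ s` on the bonds within l¹-distance
`nbRad d L` of `L•z`, `‖Qstr L W Y z κ‖ ≤ L·s` (isometric transports; every straight segment has `L` bonds). [folklore] -/
theorem norm_Qstr_le_sup [Nonempty n] {L : ℕ} (hL : 1 ≤ L) {W : Site d → Fin d → (Matrix n n ℂ)ˣ} (hWu : IsUnitaryCfg W)
    {a : ℝ} (ha : 0 ≤ a) (hsmall : 512 * (d + 1) * (d + 4) * (L : ℝ) ^ 2 * a ≤ 1) (hWa : SmallField W a)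
    (Y : Site d → Fin d → Matrix n n ℂ) (z : Site d) (κ : Fin d) {s : ℝ}
    (hY : ∀ (x : Site d) (μ : Fin d), l1 (x - (L : ℤ) • z) ≤ nbRad d L → ‖Y x μ‖ ≤ s) :
    ‖Qstr L W Y z κ‖ ≤ L * s := by
  have hwt := BlockAveragePushDirSplit.sum_blockWeight_eq_one (d := d) L hL
  refine (NE3CovariantLineSums.norm_Qstr_le hL hWu ha hsmall hWa Y z κ).trans ?_
  unfold segL1
  calc _ ≤ ∑ _r : Fin d → Fin L, ((L : ℝ) ^ d)⁻¹ * (L * s) := by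
        refine Finset.sum_le_sum fun r _ => mul_le_mul_of_nonneg_left ?_ (by positivity)
        have h := lnorm_le_length_mul_sup Y hY (seg κ (L : ℤ)) ((L : ℤ) • z + boxVec L r) (by
          rw [add_sub_cancel_left, length_seg, Int.natAbs_natCast, nbRad]
          have := l1_boxVec_le L r; omega)
        rwa [length_seg, Int.natAbs_natCast] at h
    _ = L * s := by rw [← Finset.sum_mul, hwt, one_mul]

/-- **SUP BOUND OF THE ONE-LEVEL DEFECT**: for unitary small-field `W` (`512(d+1)(d+4)L²a ≤ 1`, `SmallField W a`) and `‖Y(b)‖ ≤ s` on the bonds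
within l¹-distance `nbRad d L` of `L•z`:
`‖Dstr L W Y z κ‖ ≤ 16(d+1)(d+4)L²a · (1250·(nbRad + L) + 8·dL + 2L) · s`. [folklore] -/
theorem norm_Dstr_le_sup [Nonempty n] {L : ℕ} (hL : 1 ≤ L) {W : Site d → Fin d → (Matrix n n ℂ)ˣ} (hWu : IsUnitaryCfg W)
    {a : ℝ} (ha : 0 ≤ a) (hsmall : 512 * (d + 1) * (d + 4) * (L : ℝ) ^ 2 * a ≤ 1) (hWa : SmallField W a)
    (Y : Site d → Fin d → Matrix n n ℂ) (z : Site d) (κ : Fin d) {s : ℝ}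
    (hY : ∀ (x : Site d) (μ : Fin d), l1 (x - (L : ℤ) • z) ≤ nbRad d L → ‖Y x μ‖ ≤ s) :
    ‖Dstr L W Y z κ‖
      ≤ (16 * (d + 1) * (d + 4) * (L : ℝ) ^ 2 * a) * ((1250 * ((nbRad d L : ℝ) + L) + 8 * (d * L) + 2 * L) * s) := by
  set q : Site d := (L : ℤ) • z with hq
  have hs : 0 ≤ s := (norm_nonneg _).trans (hY q κ (by rw [hq, sub_self]; simp [l1]))
  have hwt := BlockAveragePushDirSplit.sum_blockWeight_eq_one (d := d) L hL
  have hw0 : 0 ≤ 16 * (d + 1) * (d + 4) * (L : ℝ) ^ 2 * a := by positivity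
  -- the four local weights against the sup (as in `BlockAverageDbarLinNorms.norm_dbarLin_le_sup`)
  have hseg0 : lnorm Y q (seg κ L) ≤ L * s := by
    have h := lnorm_le_length_mul_sup Y hY (seg κ (L : ℤ)) q (by rw [hq, sub_self, length_seg, Int.natAbs_natCast, nbRad]; simp [l1]; omega)
    rwa [length_seg, Int.natAbs_natCast] at h
  have hloopL1 : loopL1 L Y q κ ≤ (nbRad d L : ℝ) * s := by
    unfold loopL1
    calc _ ≤ ∑ _r : Fin d → Fin L, ((L : ℝ) ^ d)⁻¹ * ((nbRad d L : ℝ) * s) := by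
          refine Finset.sum_le_sum fun r _ => mul_le_mul_of_nonneg_left ?_ (by positivity)
          have h := lnorm_le_length_mul_sup Y hY (loopWord L κ (boxVec L r)) q (by
            rw [hq, sub_self]; simp only [l1, Pi.zero_apply, Int.natAbs_zero, Finset.sum_const_zero, zero_add]
            exact length_loopWord_le L κ r)
          exact h.trans (mul_le_mul_of_nonneg_right (by exact_mod_cast length_loopWord_le L κ r) hs)
      _ = (nbRad d L : ℝ) * s := by rw [← Finset.sum_mul, hwt, one_mul]
  have htreeL1 : treeL1' L Y q κ ≤ (d * L : ℝ) * s := by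
    unfold treeL1'
    calc _ ≤ ∑ _r : Fin d → Fin L, ((L : ℝ) ^ d)⁻¹ * ((d * L : ℝ) * s) := by
          refine Finset.sum_le_sum fun r _ => mul_le_mul_of_nonneg_left ?_ (by positivity)
          have hlen : (treeWord (boxVec L r)).length ≤ d * L := by rw [length_treeWord]; exact l1_boxVec_le L r
          have hl := l1_natCast_smul_e (d := d) L κ
          have h := lnorm_le_length_mul_sup Y hY (treeWord (boxVec L r)) (q + (L : ℤ) • e κ) (by
            rw [hq, add_sub_cancel_left, hl, length_treeWord, nbRad]; have := l1_boxVec_le L r; omega)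
          exact h.trans (mul_le_mul_of_nonneg_right (by exact_mod_cast hlen) hs)
      _ = (d * L : ℝ) * s := by rw [← Finset.sum_mul, hwt, one_mul]
  have hloc : locL1 L Y q κ ≤ (1250 * ((nbRad d L : ℝ) + L) + 8 * (d * L) + 2 * L) * s := by
    unfold locL1
    nlinarith [hseg0, hloopL1, htreeL1, hs]
  have h := norm_Qbar_sub_Qstr_le hL hWu ha hsmall hWa Y z κ
  unfold Dstr
  exact h.trans (mul_le_mul_of_nonneg_left hloc hw0)

/-! ## §5 The flat check -/

/-- `Qstr L 1 Y = Qcoarse L Y` (the transports are trivial: `dhol_flat`, `hol_flat`, `bavg_flat`). [folklore] -/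
theorem Qstr_flat (L : ℕ) (Y : Site d → Fin d → Matrix n n ℂ) : Qstr L (flat (d := d) (n := n)) Y = Qcoarse L Y := by
  funext z κ
  have hb : bavg L (flat (d := d) (n := n)) ((L : ℤ) • z) κ = 1 := by
    have := bavg_flat (d := d) (n := n) L
    exact congr_fun (congr_fun this _) κ
  show Ad (bavg L flat ((L : ℤ) • z) κ)⁻¹ (segMain L flat Y ((L : ℤ) • z) κ) = linQ L Y ((L : ℤ) • z) κ
  rw [hb, inv_one, Ad_one]
  unfold segMain linQ
  refine Finset.sum_congr rfl fun r _ => ?_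
  rw [dhol_flat, show hol (flat (d := d) (n := n)) ((L : ℤ) • z) (treeWord (boxVec L r)) = 1 from hol_flat _ _, Ad_one]

/-- `Dstr L 1 Y = 0`: at the flat background the double-bar average IS the straight block-line average. [folklore] -/
theorem Dstr_flat {L : ℕ} (hL : 1 ≤ L) (Y : Site d → Fin d → Matrix n n ℂ) : Dstr L (flat (d := d) (n := n)) Y = 0 := by
  funext z κ
  simp only [Dstr, Qbar_flat hL, Qstr_flat, sub_self, Pi.zero_apply]

/-- `QstrIter L j 1 Y = (Qcoarse L)^[j] Y`. [folklore] -/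
theorem QstrIter_flat (L : ℕ) : ∀ (j : ℕ) (Y : Site d → Fin d → Matrix n n ℂ), QstrIter L j (flat (d := d) (n := n)) Y = (Qcoarse L)^[j] Y
  | 0, _ => rfl
  | j + 1, Y => by
      rw [QstrIter_succ, NE3TangentNoGoFlat.cavg_flat, Qstr_flat, Function.iterate_succ_apply]
      exact QstrIter_flat L j _

end

end Summit.QuantumFields.BalabanUV.T4Continuum.NE3CovariantLineSumsTower
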